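import Literature.MathematicalPhysics.QuantumFieldTheory.OSDistributionSpaceGapContinuation
import Literature.Analysis.Distribution.SchwartzParameterIntegral
import HarnessLib

/-!
# Time-averaged test functions and the semigroup monotonicity bound `‖e^{-δH} v(G)‖ ≤ ‖v(G^ρ)‖`

Osterwalder–Schrader II (Comm. Math. Phys. 42 (1975)), Ch. VI.1 "From Distributions to Functions"
obtains the temperedness estimates for the analytically continued Schwinger functions from E0'
through *regularised* vectors: the regularisation `T_k` of `S_k` "can be written as the scalar
product `(Ψ₁, Ψ₂)` of two vectors in `ℋ` … whose absolute value is bounded by `‖Ψ₁‖ ‖Ψ₂‖`.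
Bounds on `‖Ψ₁‖` follow from E0'" (p. 298, and (6.10)–(6.12)). This file isolates the
Hilbert-space inequality which makes such bounds **uniform in the regularisation**, for the OS
Hilbert space and contraction semigroup `e^{-tH}` of the tree (`OSDistributionSpace*`):

* `genPairing_self_shiftGen_eq_norm_sq`, `re_genPairing_self_shiftGen_antitone` — the diagonal
  Schwinger functions across a growing gap, `t ↦ 𝔖_{2m}(ΘG* ⊗ G_t) = ⟪v(G), e^{-tH} v(G)⟫ =
  ‖e^{-(t/2)H} v(G)‖²`, are real, nonnegative and **decreasing** (contraction property);
* `genPairing_shiftGen_shiftGen` — `𝔖(Θ(G_s)* ⊗ G_{s'}) = 𝔖(ΘG* ⊗ G_{s+s'})` (E1);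
* `genPairing_average_average` — for a **time average** `G^ρ = ∫₀^δ ρ(s) G_s ds` of translates
  of a positive-time test function (`ρ` continuous; `G^ρ` any Schwartz function with these
  values), `𝔖_{2m}(Θ(G^ρ)* ⊗ G^ρ) = ∫₀^δ∫₀^δ ρ(s) ρ(s') 𝔖_{2m}(ΘG* ⊗ G_{s+s'}) ds ds'` (two
  applications of the exchange of `𝔖` with parameter integrals,
  `SchwartzMap.clm_apply_eq_intervalIntegral`);
* `re_genPairing_self_shiftGen_le_average` — **the monotonicity bound**: if moreover `ρ ≥ 0`
  and `∫₀^δ ρ = 1` then `𝔖_{2m}(ΘG* ⊗ G_{2δ}) ≤ 𝔖_{2m}(Θ(G^ρ)* ⊗ G^ρ)`, i.e.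
  `‖e^{-δH} v(G)‖ ≤ ‖v(G^ρ)‖` (`norm_shiftH_δ_le_norm_δ_average`): the double integral averages
  the decreasing function `u ↦ 𝔖(ΘG* ⊗ G_u)` over `u = s + s' ≤ 2δ`.

Use (OS II Ch. V–VI, the analytic continuation in several time variables): when the time profile
of the point of `G` nearest to the reflection plane is a mollifier of width `w → 0`, the norms
`‖v(G)‖` blow up, but `‖e^{-δH} v(G)‖ ≤ ‖v(G^ρ)‖` stays bounded by the E0' norm of the genuine
test function `G^ρ`, whose profile has width `≥ δ` whatever `w` — so the matrix elements
`⟪v(F), e^{-τH} v(G)⟫`, `Re τ ≥ 2δ`, are bounded uniformly in the regularisation.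

## References

* K. Osterwalder, R. Schrader, *Axioms for Euclidean Green's functions II*, Comm. Math. Phys.
  42 (1975) 281–305, Ch. VI.1, pp. 297–301, (6.5), (6.8), (6.10)–(6.12).
  [OsterwalderSchraderCMP1975]
* K. Osterwalder, R. Schrader, *Axioms for Euclidean Green's functions*, Comm. Math. Phys. 31
  (1973), §4.1, (4.7)–(4.9). [OsterwalderSchraderCMP1973]
-/

noncomputable section

open MeasureTheory Set Filter intervalIntegral
open _root_.Topology
open scoped InnerProductSpace NNReal ComplexConjugate SchwartzMap

namespace Literature.MathematicalPhysics.QuantumFieldTheory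

variable {d : ℕ} [NeZero d]

section SchwingerFamily
open Literature.MathematicalPhysics.QuantumLattice (SchwingerFamily IsPositiveTimeMulti)
open Literature.MathematicalPhysics.QuantumLattice.SchwingerFamily
open Literature.MathematicalPhysics.QuantumLattice.SchwingerFamily.OSSpace

variable {𝔖 : SchwingerFamily (EuclideanSpace ℝ (Fin d))}

/-- The generator of the OS pre-Hilbert space defined by a positive-time test function. [folklore] -/
abbrev mkGen {m : ℕ} (G : 𝓢((Fin m → EuclideanSpace ℝ (Fin d)), ℂ)) (hG : IsPositiveTimeMulti G) :
    PosGen d := ⟨m, ⟨G, hG⟩⟩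

/-- The test function of `mkGen`. [folklore] -/
@[simp] theorem mkGen_snd_val {m : ℕ} (G : 𝓢((Fin m → EuclideanSpace ℝ (Fin d)), ℂ))
    (hG : IsPositiveTimeMulti G) : (mkGen G hG).2.1 = G := rfl

/-! ### The diagonal Schwinger functions across a gap are squares of norms, decreasing in the gap -/

/-- `𝔖_{2m}(ΘG* ⊗ G_t) = ⟪v(G), e^{-tH} v(G)⟫` for `t ≥ 0`. [cite: OsterwalderSchraderCMP1973, §4.1 eqs. (4.7)–(4.9)] -/
theorem genPairing_self_shiftGen_eq_inner (hE1 : 𝔖.IsEuclideanCovariant) (hE2 : 𝔖.IsOSReflectionPositive) (p : PosGen d) (t : ℝ) :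
    genPairing 𝔖 p (shiftGen t p) =
      ⟪ι 𝔖 hE2 (δ 𝔖 hE2 p), shiftH hE2 t (ι 𝔖 hE2 (δ 𝔖 hE2 p))⟫_ℂ := by
  rw [shiftH_ι hE1, inner_ι_ι, shiftOp_δ, inner_δ_δ]

/-- **`𝔖_{2m}(ΘG* ⊗ G_t) = ‖e^{-(t/2)H} v(G)‖²`** for `t ≥ 0`: real and nonnegative. [cite: OsterwalderSchraderCMP1973, §4.1 eqs. (4.7)–(4.9)] -/
theorem genPairing_self_shiftGen_eq_norm_sq (hE1 : 𝔖.IsEuclideanCovariant) (hE2 : 𝔖.IsOSReflectionPositive) (p : PosGen d) {t : ℝ} (ht : 0 ≤ t) :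
    genPairing 𝔖 p (shiftGen t p) =
      ((‖shiftH hE2 (t / 2) (ι 𝔖 hE2 (δ 𝔖 hE2 p))‖ ^ 2 : ℝ) : ℂ) := by
  rw [genPairing_self_shiftGen_eq_inner hE1 hE2, inner_shiftH_self_eq_norm_sq hE1 ht]

/-- **The diagonal Schwinger function across a gap decreases with the gap**:
`Re 𝔖(ΘG* ⊗ G_t) ≤ Re 𝔖(ΘG* ⊗ G_s)` for `0 ≤ s ≤ t` (contraction property of `e^{-tH}`). [cite: OsterwalderSchraderCMP1973, §4.1 eq. (4.9)] -/
theorem re_genPairing_self_shiftGen_antitone (hE1 : 𝔖.IsEuclideanCovariant) (hE2 : 𝔖.IsOSReflectionPositive) (p : PosGen d) {s t : ℝ} (hs : 0 ≤ s) (hst : s ≤ t) :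
    (genPairing 𝔖 p (shiftGen t p)).re ≤ (genPairing 𝔖 p (shiftGen s p)).re := by
  rw [genPairing_self_shiftGen_eq_inner hE1 hE2, genPairing_self_shiftGen_eq_inner hE1 hE2]
  exact re_inner_shiftH_self_antitone hE1 _ hs hst

/-- `𝔖(Θ(F_s)* ⊗ G_{s'}) = 𝔖(ΘF* ⊗ G_{s+s'})` for `s, s' ≥ 0` (E1). [cite: OsterwalderSchraderCMP1973, §4.1 eq. (4.7)] -/
theorem genPairing_shiftGen_shiftGen (hE1 : 𝔖.IsEuclideanCovariant) (p q : PosGen d) {s s' : ℝ} (hs : 0 ≤ s) (hs' : 0 ≤ s') :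
    genPairing 𝔖 (shiftGen s p) (shiftGen s' q) = genPairing 𝔖 p (shiftGen (s + s') q) := by
  rw [genPairing_shiftGen_left 𝔖 hE1 hs, shiftGen_add hs hs']

/-! ### Time averages of translates and the exchange with `𝔖` -/

/-- Pointwise values of time translates: `G_s(x) = G(x₀ - s e₀, …)`. [folklore] -/
theorem translateMulti_timeVec_apply {m : ℕ} (G : 𝓢((Fin m → EuclideanSpace ℝ (Fin d)), ℂ))
    (s : ℝ) (x : Fin m → EuclideanSpace ℝ (Fin d)) :
    QuantumLattice.translateMulti (timeVec s) G x = G fun i => x i - timeVec s :=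
  QuantumLattice.translateMulti_apply _ G x

/-- **First exchange**: if `G'(x) = ∫₀^δ ρ(s) G_s(x) ds` pointwise then for every `n`-point `F`,
`𝔖_{n+m}(ΘF* ⊗ G') = ∫₀^δ ρ(s) 𝔖_{n+m}(ΘF* ⊗ G_s) ds`. [folklore] -/
theorem osPairing_average_right {n m : ℕ} (F : 𝓢((Fin n → EuclideanSpace ℝ (Fin d)), ℂ))
    {G G' : 𝓢((Fin m → EuclideanSpace ℝ (Fin d)), ℂ)} {ρ : ℝ → ℝ} (hρ : Continuous ρ) {L : ℝ}
    (hL : 0 ≤ L)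
    (hGG' : ∀ x, G' x = ∫ s in (0 : ℝ)..L, (ρ s : ℂ) * QuantumLattice.translateMulti (timeVec s) G x) :
    𝔖.osPairing F G' = ∫ s in (0 : ℝ)..L, (ρ s : ℂ) *
      𝔖.osPairing F (QuantumLattice.translateMulti (timeVec s) G) := by
  -- the continuous curve `s ↦ ρ(s) (ΘF* ⊗ G_s)` in `𝓢`
  set Φ : ℝ → 𝓢((Fin (n + m) → EuclideanSpace ℝ (Fin d)), ℂ) := fun s =>
    (ρ s : ℂ) • (QuantumLattice.osAdjoint F).appendTensor (QuantumLattice.translateMulti (timeVec s) G)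
    with hΦ
  have hΦc : Continuous Φ := by
    refine (Complex.continuous_ofReal.comp hρ).smul ?_
    exact QuantumLattice.continuous_appendTensor.comp
      (continuous_const.prodMk (continuous_translateMulti_timeVec G))
  have hΨ : ∀ x, ((QuantumLattice.osAdjoint F).appendTensor G') x = ∫ s in (0 : ℝ)..L, Φ s x := by
    intro x
    simp only [hΦ, SchwartzMap.appendTensor_apply, smul_apply, smul_eq_mul]
    rw [hGG', ← intervalIntegral.integral_const_mul]
    refine intervalIntegral.integral_congr fun s _ => ?_
    ring
  have h := SchwartzMap.clm_apply_eq_intervalIntegral hΦc hL hΨ ((𝔖 (n + m)).restrictScalars ℝ)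
  simp only [ContinuousLinearMap.coe_restrictScalars'] at h
  rw [SchwingerFamily.osPairing, h]
  refine intervalIntegral.integral_congr fun s _ => ?_
  simp only [hΦ, map_smul, smul_eq_mul, SchwingerFamily.osPairing]

/-- **Second exchange**: if `G'(x) = ∫₀^δ ρ(s) G_s(x) ds` pointwise (`ρ` real) then for every
`m`-point `K`, `𝔖_{n+m}(Θ(G')* ⊗ K) = ∫₀^δ ρ(s) 𝔖_{n+m}(Θ(G_s)* ⊗ K) ds` (the OS adjoint is
conjugate-linear and commutes with the real average). [folklore] -/
theorem osPairing_average_left {n m : ℕ} (K : 𝓢((Fin m → EuclideanSpace ℝ (Fin d)), ℂ))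
    {G G' : 𝓢((Fin n → EuclideanSpace ℝ (Fin d)), ℂ)} {ρ : ℝ → ℝ} (hρ : Continuous ρ) {L : ℝ}
    (hL : 0 ≤ L)
    (hGG' : ∀ x, G' x = ∫ s in (0 : ℝ)..L, (ρ s : ℂ) * QuantumLattice.translateMulti (timeVec s) G x) :
    𝔖.osPairing G' K = ∫ s in (0 : ℝ)..L, (ρ s : ℂ) *
      𝔖.osPairing (QuantumLattice.translateMulti (timeVec s) G) K := by
  set Φ : ℝ → 𝓢((Fin (n + m) → EuclideanSpace ℝ (Fin d)), ℂ) := fun s =>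
    (ρ s : ℂ) • (QuantumLattice.osAdjoint (QuantumLattice.translateMulti (timeVec s) G)).appendTensor K
    with hΦ
  have hΦc : Continuous Φ := by
    refine (Complex.continuous_ofReal.comp hρ).smul ?_
    exact QuantumLattice.continuous_appendTensor.comp
      ((QuantumLattice.continuous_osAdjoint.comp (continuous_translateMulti_timeVec G)).prodMk
        continuous_const)
  have hΨ : ∀ x, ((QuantumLattice.osAdjoint G').appendTensor K) x = ∫ s in (0 : ℝ)..L, Φ s x := by
    intro x
    simp only [hΦ, SchwartzMap.appendTensor_apply, smul_apply, smul_eq_mul,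
      QuantumLattice.osAdjoint_apply]
    rw [hGG', intervalIntegral.integral_of_le hL, intervalIntegral.integral_of_le hL, ← integral_conj,
      ← MeasureTheory.integral_mul_const]
    refine integral_congr_ae (Eventually.of_forall fun s => ?_)
    simp only [map_mul, Complex.conj_ofReal]
    ring
  have h := SchwartzMap.clm_apply_eq_intervalIntegral hΦc hL hΨ ((𝔖 (n + m)).restrictScalars ℝ)
  simp only [ContinuousLinearMap.coe_restrictScalars'] at h
  rw [SchwingerFamily.osPairing, h]
  refine intervalIntegral.integral_congr fun s _ => ?_
  simp only [hΦ, map_smul, smul_eq_mul, SchwingerFamily.osPairing]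

/-- **The OS pairing of two time averages**: with `p = (m, G)` and `p' = (m, G^ρ)`,
`G^ρ(x) = ∫₀^L ρ(s) G_s(x) ds`,
`𝔖_{2m}(Θ(G^ρ)* ⊗ G^ρ) = ∫₀^L ∫₀^L ρ(s) ρ(s') 𝔖_{2m}(ΘG* ⊗ G_{s+s'}) ds' ds`. [cite: OsterwalderSchraderCMP1975, Ch. VI.1 eqs. (6.8)–(6.10)] -/
theorem genPairing_average_average (hE1 : 𝔖.IsEuclideanCovariant) {m : ℕ} {G G' : 𝓢((Fin m → EuclideanSpace ℝ (Fin d)), ℂ)}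
    (hG : IsPositiveTimeMulti G) (hG' : IsPositiveTimeMulti G') {ρ : ℝ → ℝ} (hρ : Continuous ρ)
    {L : ℝ} (hL : 0 ≤ L)
    (hGG' : ∀ x, G' x = ∫ s in (0 : ℝ)..L, (ρ s : ℂ) * QuantumLattice.translateMulti (timeVec s) G x) :
    genPairing 𝔖 (mkGen G' hG') (mkGen G' hG') = ∫ s in (0 : ℝ)..L, ∫ s' in (0 : ℝ)..L,
      (ρ s : ℂ) * (ρ s' : ℂ) * genPairing 𝔖 (mkGen G hG) (shiftGen (s + s') (mkGen G hG)) := by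
  rw [genPairing_eq, mkGen_snd_val, osPairing_average_left (𝔖 := 𝔖) G' hρ hL hGG']
  refine intervalIntegral.integral_congr fun s hs => ?_
  have hs0 : 0 ≤ s := by
    rw [uIcc_of_le hL] at hs
    exact hs.1
  rw [osPairing_average_right (𝔖 := 𝔖) _ hρ hL hGG', ← intervalIntegral.integral_const_mul]
  refine intervalIntegral.integral_congr fun s' hs' => ?_
  have hs'0 : 0 ≤ s' := by
    rw [uIcc_of_le hL] at hs'
    exact hs'.1
  have key : 𝔖.osPairing (QuantumLattice.translateMulti (timeVec s) G)
      (QuantumLattice.translateMulti (timeVec s') G) =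
      genPairing 𝔖 (mkGen G hG) (shiftGen (s + s') (mkGen G hG)) := by
    rw [← genPairing_shiftGen_shiftGen hE1 (mkGen G hG) (mkGen G hG) hs0 hs'0,
      shiftGen_of_nonneg hs0, shiftGen_of_nonneg hs'0]
    rfl
  simp only [key]
  ring

/-- The diagonal Schwinger function across a gap as a real number. [folklore] -/
theorem genPairing_self_shiftGen_eq_ofReal_re (hE1 : 𝔖.IsEuclideanCovariant) (hE2 : 𝔖.IsOSReflectionPositive) (p : PosGen d) {t : ℝ} (ht : 0 ≤ t) :
    genPairing 𝔖 p (shiftGen t p) = ((genPairing 𝔖 p (shiftGen t p)).re : ℂ) := by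
  rw [genPairing_self_shiftGen_eq_norm_sq hE1 hE2 p ht, Complex.ofReal_re]

/-- **The monotonicity bound** (the inequality behind OS II, Ch. VI.1): if
`G^ρ(x) = ∫₀^L ρ(s) G_s(x) ds` with `ρ ≥ 0` continuous, `∫₀^δ ρ = 1`, then
`𝔖_{2m}(ΘG* ⊗ G_{2δ}) ≤ 𝔖_{2m}(Θ(G^ρ)* ⊗ G^ρ)` — the double average of the decreasing function
`u ↦ 𝔖(ΘG* ⊗ G_u)` over `u = s + s' ≤ 2δ` is at least its value at `2δ`. [cite: OsterwalderSchraderCMP1975, Ch. VI.1 pp. 298–301] -/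
theorem re_genPairing_self_shiftGen_le_average (hE1 : 𝔖.IsEuclideanCovariant) (hE2 : 𝔖.IsOSReflectionPositive) {m : ℕ}
    {G G' : 𝓢((Fin m → EuclideanSpace ℝ (Fin d)), ℂ)} (hG : IsPositiveTimeMulti G)
    (hG' : IsPositiveTimeMulti G') {ρ : ℝ → ℝ} (hρ : Continuous ρ) {L : ℝ} (hρ0 : ∀ s ∈ Icc (0 : ℝ) L, 0 ≤ ρ s)
    (hL : 0 ≤ L) (hρ1 : ∫ s in (0 : ℝ)..L, ρ s = 1)
    (hGG' : ∀ x, G' x = ∫ s in (0 : ℝ)..L, (ρ s : ℂ) * QuantumLattice.translateMulti (timeVec s) G x) :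
    (genPairing 𝔖 (mkGen G hG) (shiftGen (2 * L) (mkGen G hG))).re ≤
      (genPairing 𝔖 (mkGen G' hG') (mkGen G' hG')).re := by
  set p : PosGen d := (mkGen G hG) with hp
  set r : ℝ → ℝ := fun u => (genPairing 𝔖 p (shiftGen u p)).re with hr
  -- the double average as a real number
  have hI' : genPairing 𝔖 (mkGen G' hG') (mkGen G' hG') =
      ∫ s in (0 : ℝ)..L, ∫ s' in (0 : ℝ)..L, ((ρ s * ρ s' * r (s + s') : ℝ) : ℂ) := by
    rw [genPairing_average_average hE1 hG hG' hρ hL hGG']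
    refine intervalIntegral.integral_congr fun s hs => ?_
    have hs0 : 0 ≤ s := by rw [uIcc_of_le hL] at hs; exact hs.1
    refine intervalIntegral.integral_congr fun s' hs' => ?_
    have hs'0 : 0 ≤ s' := by rw [uIcc_of_le hL] at hs'; exact hs'.1
    simp only [hr]
    rw [← hp]
    conv_lhs => rw [genPairing_self_shiftGen_eq_ofReal_re hE1 hE2 p (add_nonneg hs0 hs'0)]
    push_cast
    ring
  have hI : genPairing 𝔖 (mkGen G' hG') (mkGen G' hG') =
      ((∫ s in (0 : ℝ)..L, ∫ s' in (0 : ℝ)..L, ρ s * ρ s' * r (s + s') : ℝ) : ℂ) := by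
    rw [hI']
    simp_rw [intervalIntegral.integral_ofReal]
  rw [hI, Complex.ofReal_re]
  -- continuity of `r`
  have hrc : Continuous r := by
    simp only [hr]
    exact Complex.continuous_re.comp (continuous_genPairing_shiftGen 𝔖 p p)
  -- compare the integrand with `ρ s ρ s' r(2δ)` pointwise
  have hpt : ∀ s ∈ Icc (0 : ℝ) L, ∀ s' ∈ Icc (0 : ℝ) L,
      ρ s * ρ s' * r (2 * L) ≤ ρ s * ρ s' * r (s + s') := by
    intro s hs s' hs'
    refine mul_le_mul_of_nonneg_left ?_ (mul_nonneg (hρ0 s hs) (hρ0 s' hs'))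
    exact re_genPairing_self_shiftGen_antitone hE1 hE2 p (add_nonneg hs.1 hs'.1)
      (by linarith [hs.2, hs'.2])
  have hinner : ∀ s ∈ Icc (0 : ℝ) L,
      ρ s * r (2 * L) ≤ ∫ s' in (0 : ℝ)..L, ρ s * ρ s' * r (s + s') := by
    intro s hs
    have h1 : ∫ s' in (0 : ℝ)..L, ρ s * ρ s' * r (2 * L) = ρ s * r (2 * L) := by
      have h2 : ∫ s' in (0 : ℝ)..L, ρ s * ρ s' * r (2 * L) = (ρ s * r (2 * L)) * ∫ s' in (0 : ℝ)..L, ρ s' := by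
        rw [← intervalIntegral.integral_const_mul]
        refine intervalIntegral.integral_congr fun s' _ => ?_
        ring
      rw [h2, hρ1, mul_one]
    rw [← h1]
    refine intervalIntegral.integral_mono_on hL ?_ ?_ fun s' hs' => hpt s hs s' hs'
    · exact ((continuous_const.mul hρ).mul continuous_const).intervalIntegrable _ _
    · exact ((continuous_const.mul hρ).mul (hrc.comp (continuous_const.add continuous_id))).intervalIntegrable _ _
  have houter : ∫ s in (0 : ℝ)..L, ρ s * r (2 * L) ≤
      ∫ s in (0 : ℝ)..L, ∫ s' in (0 : ℝ)..L, ρ s * ρ s' * r (s + s') := by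
    refine intervalIntegral.integral_mono_on hL ?_ ?_ hinner
    · exact (hρ.mul continuous_const).intervalIntegrable _ _
    · refine Continuous.intervalIntegrable ?_ _ _
      have hF : Continuous fun q : ℝ × ℝ => ρ q.1 * ρ q.2 * r (q.1 + q.2) :=
        ((hρ.comp continuous_fst).mul (hρ.comp continuous_snd)).mul
          (hrc.comp (continuous_fst.add continuous_snd))
      exact intervalIntegral.continuous_parametric_intervalIntegral_of_continuous' hF 0 L
  have h0 : ∫ s in (0 : ℝ)..L, ρ s * r (2 * L) = r (2 * L) := by
    rw [intervalIntegral.integral_mul_const, hρ1, one_mul]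
  rw [h0] at houter
  exact houter

/-- **`‖e^{-δH} v(G)‖ ≤ ‖v(G^ρ)‖`** — the monotonicity bound in Hilbert-space form: the
semigroup-damped vector of `G` is bounded by the undamped vector of any forward time average
`G^ρ = ∫₀^δ ρ(s) G_s ds` (`ρ ≥ 0`, `∫ ρ = 1`). When the time profile of `G` at the reflection
plane is a mollifier of width `w → 0` the right side is controlled by E0' uniformly in `w`
(module docstring). [cite: OsterwalderSchraderCMP1975, Ch. VI.1 pp. 298–301] -/
theorem norm_shiftH_δ_le_norm_δ_average (hE1 : 𝔖.IsEuclideanCovariant) (hE2 : 𝔖.IsOSReflectionPositive) {m : ℕ}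
    {G G' : 𝓢((Fin m → EuclideanSpace ℝ (Fin d)), ℂ)} (hG : IsPositiveTimeMulti G)
    (hG' : IsPositiveTimeMulti G') {ρ : ℝ → ℝ} (hρ : Continuous ρ) {L : ℝ} (hρ0 : ∀ s ∈ Icc (0 : ℝ) L, 0 ≤ ρ s)
    (hL : 0 ≤ L) (hρ1 : ∫ s in (0 : ℝ)..L, ρ s = 1)
    (hGG' : ∀ x, G' x = ∫ s in (0 : ℝ)..L, (ρ s : ℂ) * QuantumLattice.translateMulti (timeVec s) G x) :
    ‖shiftH hE2 L (ι 𝔖 hE2 (δ 𝔖 hE2 (mkGen G hG)))‖ ≤ ‖δ 𝔖 hE2 (mkGen G' hG')‖ := by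
  have h := re_genPairing_self_shiftGen_le_average hE1 hE2 hG hG' hρ hρ0 hL hρ1 hGG'
  rw [genPairing_self_shiftGen_eq_norm_sq hE1 hE2 _ (by positivity), Complex.ofReal_re,
    show 2 * L / 2 = L by ring] at h
  have h2 : (genPairing 𝔖 (mkGen G' hG') (mkGen G' hG')).re = ‖δ 𝔖 hE2 (mkGen G' hG')‖ ^ 2 := by
    rw [norm_δ_sq]
    rfl
  rw [h2] at h
  exact le_of_pow_le_pow_left₀ two_ne_zero (norm_nonneg _) h
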